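import Mathlib.LinearAlgebra.ExteriorPower.Basic
import Mathlib.LinearAlgebra.ExteriorPower.Basis
import Mathlib.RepresentationTheory.Basic
import Literature.Computability.AlgebraicComplexity.LinSubst
import Literature.NumberTheory.DiophantineGeometry.GLHighestWeight
import HarnessLib

/-!
# Exterior powers of a representation and the dual plethysm coefficient `b_λ(n, m)`

GCT multiplicities, continuing `Literature/NumberTheory/DiophantineGeometry/SchurWeylPlethysm.lean`
(`plethysmCoeffOfPartition`, the plethysm coefficient `a_λ(n, m)` = multiplicity of `V(λ)` in
`Sym^n Sym^m V`). Fischer–Ikenmeyer (Comput. Complexity 29 (2020), §2, eq. (2)) introduce next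
to it the **dual plethysm coefficient** `b_λ(n, m)`, the multiplicity of the Weyl module
`S^λ V` in `⋀ⁿ Symᵐ V`:

  `Sym^n Sym^m V = ⊕_λ (S^λ V)^{⊕ a_λ(n,m)}`  and  `⋀^n Sym^m V = ⊕_λ (S^λ V)^{⊕ b_λ(n,m)}`.

Their hardness theorem (Thm. 1) is proved for `a` and `b` simultaneously and the two are
intertwined by Lemma 1 (`a_λ(n, m) = b_π(n, m+1)`, `b_λ(n, m) = a_{π'}(n, m+1)`), so the
decomposition of the barrier fact
`Literature.Barriers.ValiantsHypothesis.FischerIkenmeyer2020_plethysmNPHard` needs `b` as a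
real definition. This file supplies it in the style of the tree's `a`:

* `wedgeRep ρ n` — the `n`-th exterior power `⋀ⁿ ρ` of a representation `ρ` of a monoid `G` on
  a module `V` over a commutative ring, `g ↦ ⋀ⁿ(ρ g)` (Mathlib's functorial
  `exteriorPower.map`; Mathlib has `Representation.tprod`, `dual`, `linHom` but no exterior or
  symmetric power of a representation — grep `exteriorPower` in `Mathlib/RepresentationTheory`:
  nothing);
* `dualPlethysmCoeffOfPartition k N n m λ` — the multiplicity `hwMultiplicity` (dimension of the
  space of `B`-semi-invariants, file `GLHighestWeight`) of the highest weight
  `Weight.ofPartition N λ = (λ₁, …, λ_N)` in `⋀ⁿ (formRep (Fin N) k m) = ⋀ⁿ Symᵐ (k^N)`, where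
  `formRep = Sym^m` of the standard column representation (`GLHighestWeight`,
  `hasHighestWeight_formRep_single`: highest weight `m ε₀`). For `k = ℂ`, `λ ⊢ n m` with at
  most `N` parts this is `b_λ(n, m)` (complete reducibility and the theorem of the highest
  weight, as for `a`; the classical coefficient does not depend on `dim V ≥ ℓ(λ)`).

Design. `b` is taken in the direct (polynomial) picture `⋀ⁿ Symᵐ V` with the weight
`Weight.ofPartition`, whereas the tree's `a` lives in the dual picture
`k[Sym^m V] = ⊕_d Sym^d (Sym^m V)^*` with `Weight.dualOfPartition`; both are the printed
coefficients. **Junk**: none beyond `Weight.ofPartition`'s truncation for `λ` with more than `N`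
parts (callers use `N = n m ≥ ℓ(λ)`); for `|λ| ≠ n m` the weight space is zero and the value is
the correct `0`; `⋀ⁿ` of the finite-dimensional `Symᵐ (k^N)` is finite-dimensional, so
`hwMultiplicity`'s `finrank` is never junk.

## References

* [FischerIkenmeyer2020] N. Fischer, C. Ikenmeyer, *The computational complexity of plethysm
  coefficients*, Comput. Complexity 29 (2020) 8 (arXiv:2002.00788, held), §2 (eq. (2): `a_λ`,
  `b_λ`; Weyl modules, highest weight vectors), §5 (proof of Thm. 4: weight bases of
  `⋀ⁿ Sym³ V`).
* W. Fulton, J. Harris, *Representation Theory*, GTM 129, §6.1 and Ex. 6.16 (`⋀ⁿ`, `Symⁿ` of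
  representations), §15.3, §15.5.
-/

noncomputable section

namespace Literature.Computability.AlgebraicComplexity

open Literature.NumberTheory.DiophantineGeometry

/-! ### Exterior powers of a representation -/

section Wedge

variable {k G V : Type*} [CommRing k] [Monoid G] [AddCommGroup V] [Module k V]

/-- The `n`-th **exterior power** `⋀ⁿ ρ` of a representation `ρ` of `G` on `V`:
`g ↦ ⋀ⁿ(ρ g)`, i.e. `g · (v₁ ∧ ⋯ ∧ vₙ) = (g v₁) ∧ ⋯ ∧ (g vₙ)` (functoriality of Mathlib's
`exteriorPower.map`). Fulton–Harris §6.1 / Ex. 6.16; FI 2020 §2 (`⋀ⁿ Symᵐ V` as a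
`GL(V)`-representation). [folklore] -/
def wedgeRep (ρ : Representation k G V) (n : ℕ) : Representation k G (⋀[k]^n V) where
  toFun g := exteriorPower.map n (ρ g)
  map_one' := by rw [map_one, Module.End.one_eq_id, exteriorPower.map_id]; rfl
  map_mul' g h := by rw [map_mul, Module.End.mul_eq_comp, exteriorPower.map_comp]; rfl

/-- `wedgeRep ρ n g = ⋀ⁿ(ρ g)` (unfolding lemma). [folklore] -/
@[simp] theorem wedgeRep_apply (ρ : Representation k G V) (n : ℕ) (g : G) :
    wedgeRep ρ n g = exteriorPower.map n (ρ g) :=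
  rfl

/-- The action on pure wedges: `g · (v₁ ∧ ⋯ ∧ vₙ) = (g v₁) ∧ ⋯ ∧ (g vₙ)`. [folklore] -/
theorem wedgeRep_apply_ιMulti (ρ : Representation k G V) (n : ℕ) (g : G) (v : Fin n → V) :
    wedgeRep ρ n g (exteriorPower.ιMulti k n v) = exteriorPower.ιMulti k n (ρ g ∘ v) := by
  rw [wedgeRep_apply, exteriorPower.map_apply_ιMulti]

end Wedge

/-! ### The dual plethysm coefficient -/

section DualPlethysm

variable (k : Type*) [Field k]

/-- The **dual plethysm coefficient** of a partition `λ` for `GL_N`: the multiplicity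
(`hwMultiplicity`, dimension of the space of highest-weight vectors for the upper triangular
Borel) of the highest weight `Weight.ofPartition N λ = (λ₁, …, λ_N)` in
`⋀ⁿ Symᵐ (k^N) = wedgeRep (formRep (Fin N) k m) n`. For `k` of characteristic zero and
`λ ⊢ n·m` with at most `N` parts this is Fischer–Ikenmeyer's `b_λ(n, m)`, defined by
`⋀ⁿ Symᵐ V = ⊕_λ (S^λ V)^{⊕ b_λ(n, m)}`; it is `0` when `|λ| ≠ n·m`. Companion of the tree's
`plethysmCoeffOfPartition` (`a_λ(n, m)`). [cite: FischerIkenmeyer2020, §2 (eq. (2))] -/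
def dualPlethysmCoeffOfPartition (N n m : ℕ) {d : ℕ} (lam : Nat.Partition d) : ℕ :=
  hwMultiplicity (wedgeRep (formRep (Fin N) k m) n) (Weight.ofPartition N lam)

/-- Unfolding lemma for `dualPlethysmCoeffOfPartition`. [cite: FischerIkenmeyer2020, §2 (eq. (2))] -/
theorem dualPlethysmCoeffOfPartition_def (N n m : ℕ) {d : ℕ} (lam : Nat.Partition d) :
    dualPlethysmCoeffOfPartition k N n m lam =
      hwMultiplicity (wedgeRep (formRep (Fin N) k m) n) (Weight.ofPartition N lam) :=
  rfl

/-- `Symᵐ (k^N)` (forms of degree `m` in `N` variables) is finite-dimensional (Mathlib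
`MvPolynomial.homogeneousSubmodule_fg`; stated as a theorem, not an instance, like the tree's
`finite_homogeneousSubmodule` of `MultiplicityObstructionsProofs.lean`, which is not imported
here to keep the import closure small). [folklore] -/
theorem finite_formSpace (N m : ℕ) :
    Module.Finite k (MvPolynomial.homogeneousSubmodule (Fin N) k m) :=
  Module.Finite.iff_fg.mpr (MvPolynomial.homogeneousSubmodule_fg (Fin N) k m)

/-- Hence `⋀ⁿ Symᵐ (k^N)` is finite-dimensional (Mathlib `exteriorPower.instFinite`). [folklore] -/
theorem finite_wedge_formSpace (N n m : ℕ) :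
    Module.Finite k (⋀[k]^n (MvPolynomial.homogeneousSubmodule (Fin N) k m)) :=
  haveI := finite_formSpace k N m
  inferInstance

/-- Positivity of `b_λ(n, m)` is occurrence of the highest weight `λ` in `⋀ⁿ Symᵐ (k^N)`
(finite-dimensional, so `hwMultiplicity ≠ 0 ↔ HasHighestWeight`). [folklore] -/
theorem dualPlethysmCoeffOfPartition_pos_iff (N n m : ℕ) {d : ℕ} (lam : Nat.Partition d) :
    0 < dualPlethysmCoeffOfPartition k N n m lam ↔
      HasHighestWeight (wedgeRep (formRep (Fin N) k m) n) (Weight.ofPartition N lam) := by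
  haveI := finite_wedge_formSpace k N n m
  rw [pos_iff_ne_zero, dualPlethysmCoeffOfPartition,
    hasHighestWeight_iff_hwMultiplicity_ne_zero]

end DualPlethysm

end Literature.Computability.AlgebraicComplexity
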